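import Summits.CriticalPhenomena.PercolationContinuityZ3.Theorems.PercNearOneGluingNoHeavyQuantResplitCascade
import Summits.CriticalPhenomena.PercolationContinuityZ3.Theorems.PercNearOneGluingNoHeavyQuantEpsCeilingSharp
import HarnessLib

/-!
# QUANT lane / PAPER-2 rate track (ARM-2, gen 11): NUMERALS of the re-balanced tolerance cascade at the Peierls constant `2⁻³`
# (lever (L1d), `RATE-CONSTANTS.md` §2j): `(1/2)^1776 < rsTauU 2⁻³ 3 ^ 24 < (1/2)^1775`, `d = 4/5/6`, and the kernel gain `2^209·η_tree < η_rs`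

builds on p205010 (kernel theorem, internal audit signed; external expert review pending)

Cell `prim-quant`, seat `prim-quant-arm-2` (constants bookkeeper).  Companion of `…QuantResplitCascade` (the closed forms `rs*`):
`rsK 2⁻³ ≤ 1331` (`⌈320·log 64⌉`), the corridor branch of `rsDeltaE = min(δ²/(100K), δ_corr²/4800)` binds for `d ≥ 3` at `ε = 2⁻³`
(`rsDeltaE 2⁻³ d = 1/(6 021 120 000·(d+1)²)`), the cast form of the orbit defect, and the SHARP sandwiches by `decide +kernel`
(`Quant.one_div_sandwich_of_nat`): **`d = 3`: `1776/1775`** (tree cascade at the same `ε`: `1986/1985`), `d = 4`: `4817/4816` (`5378`),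
`d = 5`: `12211/12210` (`13613`), `d = 6`: `29647/29646` (`33013`); and `2^209·epsOrbitDefect 2⁻³ 3 < rsTauU 2⁻³ 3 ^ 24`.
Second implementation: `quant/prim-quant-arm-2-g11/code/slack_census.py` + `resplit_numerals.py` (exact integers).
HONEST FRAMING: numerals of OUR re-balanced constants; no rate moves until `…QuantResplitScaleDefect` lands; class log* and the honest
sentence UNCHANGED either way.
[cite: KozmaNitzan2024, §4 (pp. 15–31)]
-/

noncomputable section

namespace Summit.CriticalPhenomena.PercolationContinuityZ3.Theorems.Quant

open MeasureTheory Literature.Probability.Percolation Literature.Probability.LatticeModels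
open Literature.Probability.Percolation.KozmaNitzan Literature.Probability.Percolation.AKN

variable {d : ℕ}

/-! ## §4. Numerals at the Peierls constant `2⁻³` -/

/-- `K_rs(2⁻³) ≤ 1331` (`⌈320·log 64⌉ = ⌈1330.84…⌉`; only the upper bound is used). [folklore] (numeric) -/
theorem rsK_eighth_le : rsK ((1 / 2 : ℝ) ^ 3) ≤ 1331 := by
  unfold rsK
  refine max_le (by norm_num) ?_
  rw [Nat.ceil_le]
  have h8 : (8 : ℝ) / (1 / 2 : ℝ) ^ 3 = 2 ^ (6 : ℕ) := by norm_num
  have h40 : (40 : ℝ) / (1 / 2 : ℝ) ^ 3 = 320 := by norm_num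
  rw [h8, h40, Real.log_pow]
  have hhi := Real.log_two_lt_d9
  push_cast
  nlinarith

/-- For `ε = 2⁻³` and `d ≥ 3` the CORRIDOR branch of `δ_E` binds: `rsDeltaE 2⁻³ d = 1/(6 021 120 000·(d+1)²)`
(`105²·100·K ≤ 4800·140²·16/64·64` with `K ≤ 1331 ≤ 1365`). [folklore] (numeric) -/
theorem rsDeltaE_eighth_eq (hd : 3 ≤ d) :
    rsDeltaE ((1 / 2 : ℝ) ^ 3) d = 1 / (6021120000 * ((d : ℝ) + 1) ^ 2) := by
  have hK := rsK_eighth_le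
  have hKr : (rsK ((1 / 2 : ℝ) ^ 3) : ℝ) ≤ 1331 := by exact_mod_cast hK
  have hK0 : (0 : ℝ) < rsK ((1 / 2 : ℝ) ^ 3) := by exact_mod_cast rsK_pos _
  have hd3 : (3 : ℝ) ≤ d := by exact_mod_cast hd
  unfold rsDeltaE rsDelta rsDeltaCorr
  have e2 : ((1 / 2 : ℝ) ^ 3 / (140 * ((d : ℝ) + 1))) ^ 2 / 4800 = 1 / (6021120000 * ((d : ℝ) + 1) ^ 2) := by
    have : (0 : ℝ) < (d : ℝ) + 1 := by positivity
    field_simp; norm_num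
  rw [min_eq_right, e2]
  rw [e2]
  -- `1/(6 021 120 000 (d+1)²) ≤ (1/8/105)²/(100K)` ⟸ `105²·64·100·K ≤ 6 021 120 000·(d+1)²`
  rw [div_pow, div_div, div_le_div_iff₀ (by positivity) (by positivity)]
  have h16 : (16 : ℝ) ≤ ((d : ℝ) + 1) ^ 2 := by nlinarith
  norm_num
  nlinarith

/-- `((1/X)²/2)^k = 1/(2^k·X^{2k})` (every real `X`). [folklore] -/
theorem castForm_aux (X : ℝ) (k : ℕ) : ((1 / X) ^ 2 / 2) ^ k = 1 / (2 ^ k * X ^ (2 * k)) := by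
  rw [pow_mul X 2 k, ← mul_pow, ← one_div_pow, div_pow (1 : ℝ) X 2, one_pow, div_div, mul_comm (X ^ 2) (2 : ℝ)]

/-- Cast form at `ε = 2⁻³`, `d ≥ 3`: `rsTauU 2⁻³ d ^ (d·2^d) = 1/(2^{d·2^d}·((6 021 120 000(d+1)²)·1)^{2·d·2^d})`
(the shape of `Quant.one_div_sandwich_of_nat`). [folklore] (numeric) -/
theorem rsTauU_eighth_pow_castForm (hd : 3 ≤ d) :
    rsTauU ((1 / 2 : ℝ) ^ 3) d ^ (d * 2 ^ d) =
      1 / (((2 ^ (d * 2 ^ d) : ℕ) : ℝ) * ((((6021120000 * (d + 1) ^ 2 : ℕ) : ℝ)) * ((1 : ℕ) : ℝ)) ^ (2 * (d * 2 ^ d))) := by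
  unfold rsTauU
  rw [rsDeltaE_eighth_eq hd]
  push_cast
  simp only [mul_one]
  exact castForm_aux _ _

/-- **`d = 3` at `2⁻³`: `(1/2)^1776 < rsTauU 2⁻³ 3 ^ 24 < (1/2)^1775`** (interval value `1775.39`; the tree's cascade at the same Peierls
constant: `(1/2)^1986 < · < (1/2)^1985`, `Quant.EpsSharp.orbit_three_three_sharp`). [folklore] (numeric) -/
theorem rsOrbit_three_three_sharp :
    (1 / 2 : ℝ) ^ 1776 < rsTauU ((1 / 2 : ℝ) ^ 3) 3 ^ (3 * 2 ^ 3) ∧ rsTauU ((1 / 2 : ℝ) ^ 3) 3 ^ (3 * 2 ^ 3) < (1 / 2 : ℝ) ^ 1775 := by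
  rw [rsTauU_eighth_pow_castForm (by norm_num)]
  exact one_div_sandwich_of_nat (A := 2 ^ (3 * 2 ^ 3)) (C := 6021120000 * (3 + 1) ^ 2) (Klo := 1) (Khi := 1) (K := 1)
    (n := 2 * (3 * 2 ^ 3)) (a := 1775) (by positivity) (by positivity) (by norm_num) le_rfl le_rfl
    (by decide +kernel) (by decide +kernel)

/-- `d = 4` at `2⁻³`: `(1/2)^4817 < rsTauU 2⁻³ 4 ^ 64 < (1/2)^4816` (tree at `2⁻³`: `5378/5377`). [folklore] (numeric) -/
theorem rsOrbit_three_four_sharp :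
    (1 / 2 : ℝ) ^ 4817 < rsTauU ((1 / 2 : ℝ) ^ 3) 4 ^ (4 * 2 ^ 4) ∧ rsTauU ((1 / 2 : ℝ) ^ 3) 4 ^ (4 * 2 ^ 4) < (1 / 2 : ℝ) ^ 4816 := by
  rw [rsTauU_eighth_pow_castForm (by norm_num)]
  exact one_div_sandwich_of_nat (A := 2 ^ (4 * 2 ^ 4)) (C := 6021120000 * (4 + 1) ^ 2) (Klo := 1) (Khi := 1) (K := 1)
    (n := 2 * (4 * 2 ^ 4)) (a := 4816) (by positivity) (by positivity) (by norm_num) le_rfl le_rfl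
    (by decide +kernel) (by decide +kernel)

/-- `d = 5` at `2⁻³`: `(1/2)^12211 < rsTauU 2⁻³ 5 ^ 160 < (1/2)^12210` (tree at `2⁻³`: `13613/13612`). [folklore] (numeric) -/
theorem rsOrbit_three_five_sharp :
    (1 / 2 : ℝ) ^ 12211 < rsTauU ((1 / 2 : ℝ) ^ 3) 5 ^ (5 * 2 ^ 5) ∧ rsTauU ((1 / 2 : ℝ) ^ 3) 5 ^ (5 * 2 ^ 5) < (1 / 2 : ℝ) ^ 12210 := by
  rw [rsTauU_eighth_pow_castForm (by norm_num)]
  exact one_div_sandwich_of_nat (A := 2 ^ (5 * 2 ^ 5)) (C := 6021120000 * (5 + 1) ^ 2) (Klo := 1) (Khi := 1) (K := 1)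
    (n := 2 * (5 * 2 ^ 5)) (a := 12210) (by positivity) (by positivity) (by norm_num) le_rfl le_rfl
    (by decide +kernel) (by decide +kernel)

/-- `d = 6` at `2⁻³`: `(1/2)^29647 < rsTauU 2⁻³ 6 ^ 384 < (1/2)^29646` (tree at `2⁻³`: `33013/33012`). [folklore] (numeric) -/
theorem rsOrbit_three_six_sharp :
    (1 / 2 : ℝ) ^ 29647 < rsTauU ((1 / 2 : ℝ) ^ 3) 6 ^ (6 * 2 ^ 6) ∧ rsTauU ((1 / 2 : ℝ) ^ 3) 6 ^ (6 * 2 ^ 6) < (1 / 2 : ℝ) ^ 29646 := by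
  rw [rsTauU_eighth_pow_castForm (by norm_num)]
  exact one_div_sandwich_of_nat (A := 2 ^ (6 * 2 ^ 6)) (C := 6021120000 * (6 + 1) ^ 2) (Klo := 1) (Khi := 1) (K := 1)
    (n := 2 * (6 * 2 ^ 6)) (a := 29646) (by positivity) (by positivity) (by norm_num) le_rfl le_rfl
    (by decide +kernel) (by decide +kernel)

/-- **Uniform closed form at `2⁻³`, every `d ≥ 3`**: `((1/2)^66/(d+1)^4)^{d·2^d} ≤ rsTauU 2⁻³ d ^ (d·2^d)` (exactly `rsTauU 2⁻³ d = 1/(2·6 021 120 000²·(d+1)^4)`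
and `2·6 021 120 000² ≤ 2^66`; the tree cascade at `2⁻³` has `(1/2)^77` here, `Quant.EpsSharp.threeOrbitDefect_ge_closedForm`). [folklore] (numeric) -/
theorem rsOrbit_three_ge_closedForm (hd : 3 ≤ d) :
    ((1 / 2 : ℝ) ^ 66 / ((d : ℝ) + 1) ^ 4) ^ (d * 2 ^ d) ≤ rsTauU ((1 / 2 : ℝ) ^ 3) d ^ (d * 2 ^ d) := by
  refine pow_le_pow_left₀ (by positivity) ?_ _
  unfold rsTauU
  rw [rsDeltaE_eighth_eq hd]
  have hD : (0 : ℝ) < ((d : ℝ) + 1) ^ 2 := by positivity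
  have e : (1 / (6021120000 * ((d : ℝ) + 1) ^ 2)) ^ 2 / 2 = 1 / (72507772108800000000 * (((d : ℝ) + 1) ^ 2) ^ 2) := by
    field_simp; norm_num
  rw [e, ← pow_mul, show (2 * 2 : ℕ) = 4 by norm_num, div_le_div_iff₀ (by positivity) (by positivity), one_mul]
  have h4 : (0 : ℝ) < ((d : ℝ) + 1) ^ 4 := by positivity
  have hnum : (1 / 2 : ℝ) ^ 66 * 72507772108800000000 ≤ 1 := by norm_num
  nlinarith

/-- **What the re-balancing buys at `d = 3`, in the kernel**: `2^209 · η_tree(2⁻³, 3) < η_rs(2⁻³, 3)` (`1985.8 − 1775.4 = 210.4` bits of base;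
`η_tree = epsOrbitDefect 2⁻³ 3 = epsTauU 2⁻³ 3 ^ 24`). [folklore] (numeric) -/
theorem two_pow_mul_epsOrbit_lt_rsOrbit_three :
    (2 : ℝ) ^ 209 * epsOrbitDefect ((1 / 2 : ℝ) ^ 3) 3 < rsTauU ((1 / 2 : ℝ) ^ 3) 3 ^ (3 * 2 ^ 3) := by
  have h1 := EpsSharp.orbit_three_three_sharp.2
  have h2 := rsOrbit_three_three_sharp.1
  have e : (2 : ℝ) ^ 209 * (1 / 2 : ℝ) ^ 1985 = (1 / 2 : ℝ) ^ 1776 := by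
    rw [show (1985 : ℕ) = 209 + 1776 by norm_num, pow_add, ← mul_assoc, ← mul_pow]; norm_num
  calc (2 : ℝ) ^ 209 * epsOrbitDefect ((1 / 2 : ℝ) ^ 3) 3 < (2 : ℝ) ^ 209 * (1 / 2 : ℝ) ^ 1985 :=
        mul_lt_mul_of_pos_left h1 (by positivity)
    _ = (1 / 2 : ℝ) ^ 1776 := e
    _ < _ := h2

/-- **`K_rs(2⁻³) = 1331` exactly** (`⌈320·log 64⌉ = ⌈1920·log 2⌉ = ⌈1330.84…⌉`, from Mathlib's nine-digit bracket of `log 2`; only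
`rsK_eighth_le` was needed by the cascade) — the printed level count of the paper's Theorem A′ instance.  Statement and proof staged by the
paper-2 §5 desk (prim-paper-s5 gen 57, `paper2/rs3/lean/…WITH-rsKeq-rsTauU.lean`), landed by ARM-2 g12 on the paper lead's ask (REQUESTS l.1259/1261).
[folklore] (numeric) -/
theorem rsK_eighth_eq : rsK ((1 / 2 : ℝ) ^ 3) = 1331 := by
  unfold rsK
  have h8 : (8 : ℝ) / (1 / 2 : ℝ) ^ 3 = 2 ^ (6 : ℕ) := by norm_num
  have h40 : (40 : ℝ) / (1 / 2 : ℝ) ^ 3 = 320 := by norm_num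
  rw [h8, h40, Real.log_pow]
  have hlo := Real.log_two_gt_d9
  have hhi := Real.log_two_lt_d9
  have hc : ⌈((6 : ℕ) : ℝ) * Real.log 2 * 320⌉₊ = 1331 := by
    rw [Nat.ceil_eq_iff (by norm_num)]
    push_cast
    constructor <;> nlinarith
  rw [hc]; rfl

/-- **The re-balanced uniqueness tolerance at `2⁻³`, `d = 3`: `(1/2)^74 < rsTauU 2⁻³ 3 < (1/2)^73`** (`rsTauU = rsDeltaE²/2 = 1/(2·96 337 920 000²)`,
`log₂ = −73.97…`; `24 · 73.97 = 1775.39`, cf. `rsOrbit_three_three_sharp`) — the single-tolerance row of the paper's constants table.  Staged by the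
paper-2 §5 desk (prim-paper-s5 gen 57), landed by ARM-2 g12 on the paper lead's ask (REQUESTS l.1261). [folklore] (numeric) -/
theorem rsTauU_eighth_three_sharp :
    (1 / 2 : ℝ) ^ 74 < rsTauU ((1 / 2 : ℝ) ^ 3) 3 ∧ rsTauU ((1 / 2 : ℝ) ^ 3) 3 < (1 / 2 : ℝ) ^ 73 := by
  unfold rsTauU
  rw [rsDeltaE_eighth_eq (le_refl 3)]
  push_cast
  constructor <;> norm_num

/-- **The two uniqueness tolerances differ by exactly one bit, every `ε`, every `d`**: `rsDeltaE ε d ^ 2 = 2 · rsTauU ε d` — the STRICT-WINDOW tolerance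
`τ_U := δ_E²` of lever (L1f) (`…QuantResplitStrictScaleDefect`, instance of record V273) versus the re-split tolerance `rsTauU = δ_E²/2` of lever (L1d);
the orbit form of this link at `d = 3` is `Resplit.two_pow_mul_rsOrbit_eq_rsStrictOrbit_three` (`24` bits). [folklore] (numeric) -/
theorem rsDeltaE_sq_eq_two_mul_rsTauU (ε : ℝ) (d : ℕ) : rsDeltaE ε d ^ 2 = 2 * rsTauU ε d := by
  unfold rsTauU
  ring

/-- **The STRICT-WINDOW uniqueness tolerance at `2⁻³`, `d = 3`: `(1/2)^73 < rsDeltaE 2⁻³ 3 ^ 2 < (1/2)^72`** (`δ_E² = 1/96 337 920 000²`, `log₂ = −72.97…`;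
`24 · 72.97 = 1751.39`, cf. `Resplit.rsStrictOrbit_three_three_sharp`: `(1/2)^1752 < (δ_E²)^24 < (1/2)^1751`) — the strict twin of `rsTauU_eighth_three_sharp`
(`74/73`), i.e. the single-tolerance row of the constants table of the `d = 3` instance of record `Resplit.oneArm_rate_Z3_three_strict` (`1 − 2⁻¹⁷⁵²`, V273).
Identified as the one §5 numeral without a strict kernel row by the paper-2 §5 desk (prim-paper-s5 gen 57, v5 register LV5-S5-6; second implementations
`paper2/rs3s/calib/` programs A/B/C), landed by ARM-2 g16. [folklore] (numeric) -/
theorem rsStrictTauU_eighth_three_sharp :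
    (1 / 2 : ℝ) ^ 73 < rsDeltaE ((1 / 2 : ℝ) ^ 3) 3 ^ 2 ∧ rsDeltaE ((1 / 2 : ℝ) ^ 3) 3 ^ 2 < (1 / 2 : ℝ) ^ 72 := by
  rw [rsDeltaE_eighth_eq (le_refl 3)]
  push_cast
  constructor <;> norm_num

end Summit.CriticalPhenomena.PercolationContinuityZ3.Theorems.Quant

end
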